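import Mathlib
import Summits.Ventures.PercRepro2.HCov
import Summits.Ventures.PercRepro2.CCTRootEdge
import Summits.Ventures.PercRepro2.EdgeCubic
import Summits.Ventures.PercRepro2.CPolarA3
import Summits.Ventures.PercRepro2.CPolarA3Marks
import Summits.Ventures.PercRepro2.PendantClusterPins

/-!
# A CLUSTER-ROOT EDGE: an edge joining the pinned-open reach of `a₃` to a root — the worlds of `a₃`
at the two pins, almost surely (blind cell PercRepro2, p5 g15; `proofs/P5-OEDGE.md` §18)

Let `e = {a₁, z}` with `z ∈ K = pinnedReach p ends a₃` (a root edge of the contracted `a₃`; `e` fractional).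
On every configuration of positive weight `a₃ ↔ z`, so with `e` open `a₃ ↔ a₁`: at `p[e↦1]` the worlds
`PD`, `T` of `a₃` are null and `T′ = Q` (`prob_one_PD_inter_ae`, `prob_one_T_inter_ae`,
`prob_one_T'_inter_ae` — the almost-sure twins of A3RootEdge's `prob_one_PD_inter` …); and at `p[e↦0]`
(the reach unchanged by a closed pin) the worlds of `a₃` are the worlds of `z`
(`prob_zero_PD_z_eq`, `prob_zero_T_z_eq`, `prob_zero_T'_z_eq`, `Do_zero_z_eq`, `DEF_zero_z_eq`), so the
generic root-edge pieces `dfc_nonneg` / `dgc_nonneg` of A3RootEdge, stated for the edge `{a₁, z}`,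
speak about `a₃`'s masses. The Bernstein coefficients follow in ClusterRootBern.lean.
-/

namespace Summit.Ventures.PercRepro2

open UnionCluster CovForm CovForm.CPolarA3 PendantCluster

namespace ClusterRoot

section Conn

variable {V : Type*} {E : Type*} [Fintype E] [DecidableEq E] {R : Type*} [Field R]
  [LinearOrder R]

variable {p : E → R} {ends : E → Sym2 V} {e : E} {a₁ a₃ z : V}

/-- With `e = {a₁, z}` open and `z` in the reach, `a₃ ↔ a₁` on every configuration of positive weight. -/
lemma conn_update_true_a3_root (hends : ends e = s(a₁, z)) (hz : z ∈ pinnedReach p ends a₃)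
    {ω : Config E} (hw : weight p ω ≠ 0) : Conn ends (Function.update ω e true) a₃ a₁ := by
  have h3z : Conn ends (Function.update ω e true) a₃ z :=
    conn_mono (le_update_true ω e) (conn_of_mem_pinnedReach hw hz)
  have hz1 : OpenAdj ends (Function.update ω e true) z a₁ := by
    refine ⟨e, by simp, ?_⟩
    rw [hends, Sym2.eq_swap]
  exact conn_trans h3z (conn_of_openAdj hz1)

/-- With `e` pinned closed, `a₃ ↔ z` on every configuration of positive weight for `p[e↦0]`
(the reach is unchanged by a closed pin). -/
lemma conn_update_zero_a3_z (hz : z ∈ pinnedReach p ends a₃) (hf1 : p e ≠ 1)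
    {ω : Config E} (hw : weight (Function.update p e 0) ω ≠ 0) : Conn ends ω a₃ z := by
  have hz' : z ∈ pinnedReach (Function.update p e 0) ends a₃ := by
    rw [pinnedReach_update_zero hf1]; exact hz
  exact conn_of_mem_pinnedReach hw hz'

end Conn

section Pins

variable {V : Type*} {E : Type*} [Fintype E] [DecidableEq E] {R : Type*} [Field R]
  [LinearOrder R]

variable (p : E → R) {ends : E → Sym2 V} {e : E} {a₁ a₃ z : V} (a₂ : V)
  (hends : ends e = s(a₁, z)) (hz : z ∈ pinnedReach p ends a₃)

include hends hz

open CCT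

/-- At `p[e↦1]` the world `PD` of `a₃` is null (`a₃ ∈ C₁` a.s.). -/
lemma prob_one_PD_inter_ae (X : Set (Config E)) :
    prob (Function.update p e 1) (PDEvent ends a₁ a₂ a₃ ∩ X) = 0 := by
  rw [prob_update_one_eq]
  refine prob_eq_zero_of_weight_eq_zero p _ fun ω hω => ?_
  by_contra hw
  have h31 := conn_update_true_a3_root hends hz hw
  have hPD := hω.1
  simp only [PDEvent, Dtilde, Set.mem_inter_iff, Set.mem_compl_iff, mem_inU] at hPD
  exact hPD.2 (Or.inl h31)

/-- At `p[e↦1]` the world `T = {a₃ ∈ C₂}` is null. -/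
lemma prob_one_T_inter_ae (X : Set (Config E)) :
    prob (Function.update p e 1) (TEvent ends a₁ a₂ a₃ ∩ X) = 0 := by
  rw [prob_update_one_eq]
  refine prob_eq_zero_of_weight_eq_zero p _ fun ω hω => ?_
  by_contra hw
  have h31 := conn_update_true_a3_root hends hz hw
  have hT := hω.1
  simp only [TEvent, Set.mem_inter_iff, Set.mem_compl_iff, mem_connEvent] at hT
  exact hT.1 (conn_trans hT.2 h31)

/-- At `p[e↦1]` the world `T′ = {a₃ ∈ C₁}` is all of `Q`. -/
lemma prob_one_T'_inter_ae (X : Set (Config E)) :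
    prob (Function.update p e 1) (TEvent ends a₂ a₁ a₃ ∩ X) =
      prob (Function.update p e 1) (avoidAll ends a₂ {a₁} ∩ X) := by
  rw [prob_update_one_eq, prob_update_one_eq]
  refine prob_congr_of_weight p _ _ fun ω hw => ?_
  have h31 := conn_update_true_a3_root hends hz hw
  simp only [Set.mem_setOf_eq, Set.mem_inter_iff, TEvent, Set.mem_compl_iff, mem_connEvent,
    mem_avoidAll, Finset.mem_singleton, forall_eq]
  constructor
  · rintro ⟨⟨h1, _⟩, hX⟩
    exact ⟨fun hc => h1 (conn_symm hc), hX⟩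
  · rintro ⟨h1, hX⟩
    exact ⟨⟨fun hc => h1 (conn_symm hc), conn_symm h31⟩, hX⟩

/-- At `p[e↦1]`, `P(PD) = 0`. -/
lemma prob_one_PD_ae : prob (Function.update p e 1) (PDEvent ends a₁ a₂ a₃) = 0 := by
  have h := prob_one_PD_inter_ae p a₂ hends hz Set.univ
  simpa only [Set.inter_univ] using h

/-- At `p[e↦1]`, `P(T) = 0`. -/
lemma prob_one_T_ae : prob (Function.update p e 1) (TEvent ends a₁ a₂ a₃) = 0 := by
  have h := prob_one_T_inter_ae p a₂ hends hz Set.univ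
  simpa only [Set.inter_univ] using h

/-- At `p[e↦1]`, `P(T′) = P(Q)`. -/
lemma prob_one_T'_ae : prob (Function.update p e 1) (TEvent ends a₂ a₁ a₃) =
    prob (Function.update p e 1) (avoidAll ends a₂ {a₁}) := by
  have h := prob_one_T'_inter_ae p a₂ hends hz Set.univ
  simpa only [Set.inter_univ] using h

omit hends in
/-- At `p[e↦0]`, `P(PD_z ∩ X) = P(PD_{a₃} ∩ X)` (`z ↔ a₃` a.s.). -/
lemma prob_zero_PD_z_eq (hf1 : p e ≠ 1) (X : Set (Config E)) :
    prob (Function.update p e 0) (PDEvent ends a₁ a₂ z ∩ X) =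
      prob (Function.update p e 0) (PDEvent ends a₁ a₂ a₃ ∩ X) := by
  refine prob_congr_of_weight _ _ _ fun ω hw => ?_
  have h3z := conn_update_zero_a3_z hz hf1 hw
  simp only [Set.mem_inter_iff, PDEvent, Dtilde, Set.mem_compl_iff, mem_inU]
  constructor
  · rintro ⟨⟨hQ, hU⟩, hX⟩
    refine ⟨⟨hQ, ?_⟩, hX⟩
    rintro (h | h)
    · exact hU (Or.inl (conn_trans (conn_symm h3z) h))
    · exact hU (Or.inr (conn_trans (conn_symm h3z) h))
  · rintro ⟨⟨hQ, hU⟩, hX⟩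
    refine ⟨⟨hQ, ?_⟩, hX⟩
    rintro (h | h)
    · exact hU (Or.inl (conn_trans h3z h))
    · exact hU (Or.inr (conn_trans h3z h))

omit hends in
/-- At `p[e↦0]`, `P(T_z ∩ X) = P(T_{a₃} ∩ X)`. -/
lemma prob_zero_T_z_eq (hf1 : p e ≠ 1) (X : Set (Config E)) :
    prob (Function.update p e 0) (TEvent ends a₁ a₂ z ∩ X) =
      prob (Function.update p e 0) (TEvent ends a₁ a₂ a₃ ∩ X) := by
  refine prob_congr_of_weight _ _ _ fun ω hw => ?_
  have h3z := conn_update_zero_a3_z hz hf1 hw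
  simp only [Set.mem_inter_iff, TEvent, Set.mem_compl_iff, mem_connEvent]
  constructor
  · rintro ⟨⟨hQ, h2z⟩, hX⟩
    exact ⟨⟨hQ, conn_trans h2z (conn_symm h3z)⟩, hX⟩
  · rintro ⟨⟨hQ, h23⟩, hX⟩
    exact ⟨⟨hQ, conn_trans h23 h3z⟩, hX⟩

omit hends in
/-- At `p[e↦0]`, `P(T′_z ∩ X) = P(T′_{a₃} ∩ X)`. -/
lemma prob_zero_T'_z_eq (hf1 : p e ≠ 1) (X : Set (Config E)) :
    prob (Function.update p e 0) (TEvent ends a₂ a₁ z ∩ X) =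
      prob (Function.update p e 0) (TEvent ends a₂ a₁ a₃ ∩ X) := by
  refine prob_congr_of_weight _ _ _ fun ω hw => ?_
  have h3z := conn_update_zero_a3_z hz hf1 hw
  simp only [Set.mem_inter_iff, TEvent, Set.mem_compl_iff, mem_connEvent]
  constructor
  · rintro ⟨⟨hQ, h1z⟩, hX⟩
    exact ⟨⟨hQ, conn_trans h1z (conn_symm h3z)⟩, hX⟩
  · rintro ⟨⟨hQ, h13⟩, hX⟩
    exact ⟨⟨hQ, conn_trans h13 h3z⟩, hX⟩

omit hends in
/-- At `p[e↦0]`, `P(PD_z) = P(PD_{a₃})`. -/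
lemma prob_zero_PD_z (hf1 : p e ≠ 1) :
    prob (Function.update p e 0) (PDEvent ends a₁ a₂ z) =
      prob (Function.update p e 0) (PDEvent ends a₁ a₂ a₃) := by
  have h := prob_zero_PD_z_eq (a₁ := a₁) p a₂ hz hf1 Set.univ
  simpa only [Set.inter_univ] using h

omit hends in
/-- At `p[e↦0]`, `P(T_z) = P(T_{a₃})`. -/
lemma prob_zero_T_z (hf1 : p e ≠ 1) :
    prob (Function.update p e 0) (TEvent ends a₁ a₂ z) =
      prob (Function.update p e 0) (TEvent ends a₁ a₂ a₃) := by
  have h := prob_zero_T_z_eq (a₁ := a₁) p a₂ hz hf1 Set.univ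
  simpa only [Set.inter_univ] using h

omit hends in
/-- At `p[e↦0]`, `P(T′_z) = P(T′_{a₃})`. -/
lemma prob_zero_T'_z (hf1 : p e ≠ 1) :
    prob (Function.update p e 0) (TEvent ends a₂ a₁ z) =
      prob (Function.update p e 0) (TEvent ends a₂ a₁ a₃) := by
  have h := prob_zero_T'_z_eq (a₁ := a₁) p a₂ hz hf1 Set.univ
  simpa only [Set.inter_univ] using h

omit hends in
/-- At `p[e↦0]`, `D_o` of `z` is `D_o` of `a₃`. -/
lemma Do_zero_z_eq (hf1 : p e ≠ 1) (o : V) :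
    Do (Function.update p e 0) ends o a₁ a₂ z = Do (Function.update p e 0) ends o a₁ a₂ a₃ := by
  unfold Do
  rw [prob_zero_PD_z_eq p a₂ hz hf1, prob_zero_PD_z_eq p a₂ hz hf1]

omit hends in
/-- At `p[e↦0]`, `D·E_Q[F]` of `z` is that of `a₃`. -/
lemma DEF_zero_z_eq (hf1 : p e ≠ 1) (o : V) :
    DEF (Function.update p e 0) ends o a₁ a₂ z = DEF (Function.update p e 0) ends o a₁ a₂ a₃ := by
  unfold DEF EQ3 EQ3o
  rw [prob_zero_PD_z p a₂ hz hf1, Do_zero_z_eq p a₂ hz hf1 o, prob_zero_T_z p a₂ hz hf1,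
    prob_zero_T'_z p a₂ hz hf1, prob_zero_T_z_eq p a₂ hz hf1, prob_zero_T_z_eq p a₂ hz hf1,
    prob_zero_T'_z_eq p a₂ hz hf1, prob_zero_T'_z_eq p a₂ hz hf1]

end Pins

end ClusterRoot

end Summit.Ventures.PercRepro2
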